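import Literature.Algebra.EuclideanLattices.GapCVPCoNPCompleteness
import Literature.Algebra.EuclideanLattices.FarCertMachine
import Literature.Algebra.EuclideanLattices.GapCVPVerifier
import Literature.Computability.Complexity.TimeBoundsProofs
import Literature.Algebra.EuclideanLattices.KhotMachineFP
import Literature.Computability.Complexity.GapSetCoverProofs
import HarnessLib

/-!
# Aharonov–Regev 2005, Thm. 1.1 (coNP part) and Cor. 1.2: discharge of the vendored facts

Topic `Algebra/EuclideanLattices` (family `pqc`), sibling proof file of `LatticeComplexity.lean` and
`LatticeGapNPcoNP.lean` (D-0014: the named facts `gapSVP_sqrt_mem_promiseNP_inter_promiseCoNP`,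
`gapCVP_sqrt_mem_promiseNP_inter_promiseCoNP` (pqc.S16, Aharonov–Regev 2005, Cor. 1.2 / Thm. 1.1)
and the shared leaf `gapCVP_sqrt_mem_promiseCoNP` (Thm. 1.1, coNP part) stay `def`s there and are
discharged here). Everything below is a one-line assembly of PROVED results of the tree:

* Lemma A.1 (`AharonovRegev2005_lemmaA1_holds`, `LatticeGapNPcoNPLemmaA1.lean`): `GapSVP_γ' ≤ GapCVP_γ`;
* the NP parts (`gapSVP_mem_promiseNP_holds`, `GapSVPVerifier.lean`; `gapCVP_mem_promiseNP_holds`,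
  `GapCVPVerifier.lean`);
* the coNP part through the integer far-ness certificate `FarCert` (`GapCVPCoNPWitness.lean`):
  soundness `not_accepts_of_yes` (§6.1), completeness `FarCert.complete_holds`
  (`GapCVPCoNPCompleteness.lean`: dual Gaussian sampling `GapCVPCoNPSample.lean`, exact Gram
  certificates `LinearAlgebra/Matrix/IntegerGramCertificate.lean`), and the polynomial-time verifier
  machine `FarCert.verifier_mem_P_holds` (`FarCertMachine.lean`).

Main results: `gapCVP_sqrt_mem_promiseCoNP_holds`, **`gapSVP_sqrt_mem_promiseNP_inter_promiseCoNP_holds`**,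
`gapCVP_sqrt_mem_promiseNP_inter_promiseCoNP_holds` (the constant is `c = 200`; the printed proof
uses Chernoff–Hoeffding and an `ε`-net where the tree uses second moments, and certifies the
eigenvalue test by an exact Gram identity — variants recorded in the respective docstrings).

## Randomised hardness along Karp reductions (Arora–Barak 2009, Thm. 2.8(1) with Def. 7.16)

The last section discharges the named fact `PromiseProblem.IsRandHard.of_polyTimeReducible` of
`LatticeComplexity.lean` (local glue on G01: randomised `C`-hardness of a promise problem `Q`
passes to any `Q'` with `Q ≤ₚ Q'`) as `PromiseProblem.IsRandHard.of_polyTimeReducible_holds`.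
Printed argument: the proof of Arora–Barak, Thm. 2.8(1) (transitivity of `≤ₚ`: "the mapping
`x ↦ f₂(f₁(x))` … takes polynomial time to compute given `x`. Finally, `f₂(f₁(x)) ∈ L''` iff
`f₁(x) ∈ L'`"), run with a randomised first stage in the sense of Def. 7.16 (§7.6): the composite
`B(x; r) := f (A(x; r))` keeps the coins of `A`, is PPT by the tree's composition of
polynomial-time machines `PolyTimeComputable.comp_holds` (`Computability/Complexity/
TimeBoundsProofs.lean`, Mathlib's `proof_wanted Turing.TM2ComputableInPolyTime.comp`), and its
output law is the push-forward of that of `A` under `f` (`PMF.map_comp`,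
`PMF.toOuterMeasure_map_apply`), so the success probability can only increase along
`Q.yes ⊆ f⁻¹(Q'.yes)`, `Q.no ⊆ f⁻¹(Q'.no)`.

## Khot 2005, Thm. 1.1 (`p = 2`): discharge of `gapSVP_const_isNPHardRandomized` (pqc.S17)

The final section (appended 2026-08-15) discharges the named fact `gapSVP_const_isNPHardRandomized`
of `LatticeComplexity.lean` — for every constant `γ₀ ≥ 1`, `GapSVP_{γ₀}` in the Euclidean norm is
NP-hard under randomised polynomial-time reductions (Khot, J. ACM 52 (2005), Thm. 1.1, first
assertion, `p = 2`) — as `gapSVP_const_isNPHardRandomized_holds`. The printed proof is followed: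
its INPUT, the PCP-based NP-hardness of gap exact set cover for every constant ratio (Khot §3,
from Arora–Babai–Stern–Sweedyk 1997, Prop. 6 = Bellare–Goldwasser–Lund–Russell 1993), is the tree's
`AroraEtAl1997_prop6_holds` (`Computability/Complexity/GapSetCoverProofs.lean`: Dinur's proof of the
PCP theorem as a gap machine, label cover with every constant soundness error, Lund–Yannakakis); the
REDUCTION ITSELF (Khot §§3–7: the CVP instance of Thm. 3.1, the BCH augmentation of Thm. 4.1 /
Lemmas 4.2–4.3, the random sub-lattice of Thm. 5.1 / Lemmas 5.4–5.8, the augmented tensor power of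
§§6–7 and the final `2/3`-`2/3` error bookkeeping, together with its explicit polynomial-time
machine) is the chain `KhotTensorBoost` → `KhotBasicReduction` → `KhotGapInstance` →
`KhotRandomSublattice` → `KhotCounting` → `KhotRecoverable` → `KhotParameters` → `KhotAssembly` →
`KhotReduction` → `KhotExplicitReduction` → `KhotOutputTable` / `KhotBaseTable` / `KhotParamsFP` /
`KhotTablesFP` → `KhotMachineFP`, whose end point is `Khot.gapSVP_const_isNPHardRandomized_of_prop6 :
AroraEtAl1997_prop6 → gapSVP_const_isNPHardRandomized`. Deviations from print that keep the
STATEMENT and only simplify the PROOF are recorded in those files (power-of-two modulus instead of a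
prime in Lemmas 5.6–5.8, exact coin sampling; two-sided error `≤ 1/3` as in the tree's
`IsNPHardRandomized`, which Khot's one-sided `9/10` bounds imply).

## References

* S. Arora, B. Barak, *Computational Complexity: A Modern Approach*, CUP 2009, Thm. 2.8(1) and its
  proof (book p. 43), Def. 7.16 (§7.6, book p. 138).
* S. Khot, *Hardness of approximating the shortest vector problem in lattices*, J. ACM 52 (2005)
  789–808, Thm. 1.1, Thm. 3.1, Thm. 4.1, Lemmas 4.2–4.3, Thm. 5.1, Lemmas 5.4–5.8, §§6–7 (§7.3).
* S. Arora, L. Babai, J. Stern, Z. Sweedyk, *The hardness of approximate optima in lattices, codes,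
  and systems of linear equations*, J. Comput. System Sci. 54 (1997) 317–331, Prop. 6 (p. 319).
* D. Aharonov, O. Regev, *Lattice problems in NP ∩ coNP*, J. ACM 52 (2005) 749–765, Thm. 1.1,
  Cor. 1.2, Lemma A.1, §6.
-/

namespace Literature.Algebra.EuclideanLattices

/-- **Aharonov–Regev 2005, Thm. 1.1, coNP part** — discharge of `gapCVP_sqrt_mem_promiseCoNP`:
`GapCVP_{c√n} ∈ PromiseCoNP` for some `c > 0` (here `c = 200`). [cite: AharonovRegev2005, Thm. 1.1 (p. 2) and §6] -/
theorem gapCVP_sqrt_mem_promiseCoNP_holds : gapCVP_sqrt_mem_promiseCoNP :=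
  gapCVP_sqrt_mem_promiseCoNP_of_verifier FarCert.verifier_mem_P_holds

/-- **Aharonov–Regev 2005, Cor. 1.2** — discharge of `gapSVP_sqrt_mem_promiseNP_inter_promiseCoNP`
(pqc.S16, `GapSVP` half): `GapSVP_{c√n} ∈ PromiseNP ∩ PromiseCoNP` for some `c > 0`.
[cite: AharonovRegev2005, Cor. 1.2 (p. 2), from Thm. 1.1 and Lemma A.1 (p. 14)] -/
theorem gapSVP_sqrt_mem_promiseNP_inter_promiseCoNP_holds : gapSVP_sqrt_mem_promiseNP_inter_promiseCoNP :=
  gapSVP_sqrt_mem_promiseNP_inter_promiseCoNP_of_verifier FarCert.verifier_mem_P_holds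

/-- **Aharonov–Regev 2005, Thm. 1.1** — discharge of `gapCVP_sqrt_mem_promiseNP_inter_promiseCoNP`
(pqc.S16, `GapCVP` half): `GapCVP_{c√n} ∈ PromiseNP ∩ PromiseCoNP` for some `c > 0`.
[cite: AharonovRegev2005, Thm. 1.1 (p. 2)] -/
theorem gapCVP_sqrt_mem_promiseNP_inter_promiseCoNP_holds : gapCVP_sqrt_mem_promiseNP_inter_promiseCoNP :=
  (gapSVP_and_gapCVP_sqrt_mem_of_coNP_part gapCVP_sqrt_mem_promiseCoNP_holds).2


/-! ### Randomised hardness is upward closed along Karp reductions (discharge) -/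

section RandHard

open Literature.Computability.Complexity Literature.Computability.Complexity.PromiseProblem

/-- **Discharge of `PromiseProblem.IsRandHard.of_polyTimeReducible`**: randomised hardness is
upward closed along deterministic (Karp) promise reductions on the right.  The printed argument
is the proof of Arora–Barak, Thm. 2.8(1) (transitivity of `≤ₚ`, book p. 43): "the mapping
`x ↦ f₂(f₁(x))` is a polynomial-time reduction … since `f₂(f₁(x))` takes polynomial time to
compute given `x`.  Finally, `f₂(f₁(x)) ∈ L''` iff `f₁(x) ∈ L'`", run with a randomised first
stage `f₁ = A(·; r)` in the sense of Def. 7.16 (§7.6, book p. 138).  Formally: from a PPT `A`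
reducing `ofLanguage L` to `Q` and `f ∈ FP` reducing `Q` to `Q'`, the composite algorithm
`B(x; r) := f (A(x; r))` with the SAME coin budget is PPT, because `uncurry B.run = f ∘ uncurry
A.run` is a sequential composite of polynomial-time machines (`PolyTimeComputable.comp_holds`,
the tree's discharge of Mathlib's `proof_wanted Turing.TM2ComputableInPolyTime.comp`) and the
coin polynomial is unchanged; and its output law is the push-forward of that of `A` under `f`
(`PMF.map_comp`), whence `Pr_r[B(x; r) ∈ Q'.yes] = Pr_r[A(x; r) ∈ f⁻¹(Q'.yes)] ≥
Pr_r[A(x; r) ∈ Q.yes] ≥ 2/3` on yes-instances, as `f` maps `Q.yes` into `Q'.yes`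
(`PMF.toOuterMeasure_map_apply`, monotonicity of the outer measure); likewise on no-instances.
[Arora–Barak 2009, Thm. 2.8(1) and its proof (p. 43); Def. 7.16, §7.6 (p. 138)]
[cite: AroraBarak2009, Thm. 2.8(1) (proof, p. 43) and §7.6, Def. 7.16 (p. 138)] -/
theorem _root_.Literature.Computability.Complexity.PromiseProblem.IsRandHard.of_polyTimeReducible_holds :
    IsRandHard.of_polyTimeReducible := by
  intro C Q Q' hQ hQQ' L hL
  obtain ⟨A, hA, hy, hn⟩ := hQ L hL
  obtain ⟨f, hf, hfy, hfn⟩ := hQQ'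
  obtain ⟨p, hp⟩ := hA.2
  -- output law of the composite `B(x; r) := f (A(x; r))` (same coins): push-forward under `f`
  have hB : ∀ (x : List Bool) (E : Set (List Bool)),
      (⟨fun x r => f (A.run x r), A.coinLen⟩ : RandAlg (List Bool) (List Bool)).pr id x E =
        A.pr id x (f ⁻¹' E) := by
    intro x E
    simp only [RandAlg.pr, RandAlg.outputPMF]
    rw [← PMF.toOuterMeasure_map_apply, PMF.map_comp, Function.comp_def]
  -- monotonicity of `Pr_r[A(x; r) ∈ E]` in the event `E`
  have hmono : ∀ (x : List Bool) {E E' : Set (List Bool)}, E ⊆ E' →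
      A.pr id x E ≤ A.pr id x E' := by
    intro x E E' hEE'
    refine ENNReal.toReal_mono ?_ ((A.outputPMF id x).toOuterMeasure.mono hEE')
    rw [PMF.toOuterMeasure_apply]
    exact (A.outputPMF id x).tsum_coe_indicator_ne_top E'
  refine ⟨⟨fun x r => f (A.run x r), A.coinLen⟩, ⟨?_, p, hp⟩, fun x hx => ?_, fun x hx => ?_⟩
  · -- polynomial time: `uncurry B.run = f ∘ uncurry A.run`, composition of machines
    exact PolyTimeComputable.comp_holds hf hA.1
  · rw [hB]
    exact (hy x hx).trans (hmono x fun y hy' => hfy hy')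
  · rw [hB]
    exact (hn x hx).trans (hmono x fun y hy' => hfn hy')

end RandHard

/-! ### Khot 2005, Thm. 1.1, first assertion, `p = 2` (discharge, appended 2026-08-15) -/

section Khot

open Literature.Computability.Complexity

/-- **Khot 2005, Thm. 1.1 (first assertion, Euclidean norm), PROVED** — discharge of the named fact
`gapSVP_const_isNPHardRandomized` (pqc.S17): for every constant `γ₀ ≥ 1`, the promise problem
`GapSVP_{γ₀}` is NP-hard under randomised polynomial-time many-one reductions (two-sided error
`≤ 1/3`). Proof, as printed: the NP-hardness of gap exact set cover for every constant ratio
(`AroraEtAl1997_prop6_holds` — the PCP theorem via Dinur's gap machine, label cover, Lund–Yannakakis;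
Khot's input, §3 before Thm. 3.1) fed to Khot's randomised reduction SAT → CVP → BCH-augmented
lattice → random sub-lattice → augmented tensor power → GapSVP with its explicit polynomial-time
machine (`Khot.gapSVP_const_isNPHardRandomized_of_prop6`, `KhotMachineFP.lean`, assembling Khot
Thm. 3.1, Thm. 4.1, Lemmas 4.2–4.3, Thm. 5.1 with Lemmas 5.4–5.8, Lemmas 7.1–7.2 and §7.3).
[cite: Khot2005, Thm. 1.1 (p. 791) and §7.3; AroraEtAl1997, Prop. 6 (p. 319)] -/
theorem gapSVP_const_isNPHardRandomized_holds : gapSVP_const_isNPHardRandomized :=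
  Khot.gapSVP_const_isNPHardRandomized_of_prop6 AroraEtAl1997_prop6_holds

end Khot

end Literature.Algebra.EuclideanLattices
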